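import Summits.CriticalPhenomena.Ising3DConformalLimit.Theorems.EnergyNotSigmaSquaredGapForcesFarMergingScreeningDefsUnpin

/-!
# Hypothesis-free envelopes of the two reshaped stubs of line `screening-form-lemma-a1`
(crux `GapForcesFarMerging`, item stmt-CriticalPhenomena-4468, route `EnergyNotSigmaSquared`; lead seat c2;
helper file of the registered stubs `stub_hazardRelocation : HazardRelocation`, `stub_unpin : Unpin`)

Both reshaped currencies are IMPLICATIONS whose hypothesis is an opaque octave of the screening ladder. This file
records, kernel-checked, the obvious hypothesis-free statements that imply them — their "upper envelopes" — so that
the planners can read off what a proof that IGNORES the hypothesis would have to establish: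

* `hazardRelocation_of_opacityEverywhere` — if EVERY large octave `k` of the bounded-aspect ladder (far ends at
  `2^{k+3}`) is opaque eventually in the box size, `HazardRelocation` holds. That envelope is a per-octave hazard LOWER
  bound, i.e. a uniform form of the one-pinch power law: GAP-strength (route crux `EnergyGapPowerLaw`, item 4469, in
  ladder clothing), so a hypothesis-free proof of S6a is not to be expected; the content of S6a proper is the
  COMPARISON of the hazard at far scale `m` with the hazard at far scale `2^{k+3}` (ratio-form far-source insensitivity).
* `unpin_of_uniformFarScreening` — if at EVERY large windowed octave some fresh probe of the finite family is screened
  (far screening at all windowed scales: lattice non-triviality, crux 0636-strength), `Unpin` holds. So the content of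
  S6b proper is the passage from the TILTED PINNED probe to a FRESH UN-PINNED one at the same scale (un-tilt + un-pin).
No lattice input; pure logic over the Defs vocabulary.
-/

noncomputable section

namespace Summit.CriticalPhenomena.Ising3DConformalLimit.GapForcesFarMergingScreening

open scoped symmDiff ENNReal
open MeasureTheory Filter Finset
open Literature.Probability.LatticeModels Literature.Probability.Percolation
open Summit.CriticalPhenomena.Ising3DConformalLimit.Theorems.GapForcesFarMerging.Negative
  (e₁ e₂ cc2 xR up dn FarMergingShape SinglePinchLawShape)

/-- **Envelope of S6a.** Opacity of every large bounded-aspect octave (eventually in the box size) implies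
`HazardRelocation` (the hypothesis on the far scale `m` is simply dropped). [folklore] -/
theorem hazardRelocation_of_opacityEverywhere :
    (∃ c' : ℝ, 0 < c' ∧ ∀ᶠ k : ℕ in atTop, ∀ᶠ n : ℕ in atTop,
      0 < pinchScreen n (2 ^ k) (2 ^ (k + 3)) ∧
        pinchScreen n (2 ^ (k + 1)) (2 ^ (k + 3)) ≤ (1 - c') * pinchScreen n (2 ^ k) (2 ^ (k + 3))) →
    HazardRelocation := by
  rintro ⟨c', hc', hk⟩ c _
  exact ⟨c', hc', hk.mono fun k hkk _ _ => hkk.mono fun n hn _ => hn⟩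

/-- **Envelope of S6b.** Far screening of some fresh probe of a finite family at every large windowed octave
(eventually in the box size) implies `Unpin` (the opacity hypothesis is simply dropped). [folklore] -/
theorem unpin_of_uniformFarScreening :
    (∀ θ : ℝ, 0 < θ → ∃ c' : ℝ, 0 < c' ∧ ∃ j : ℕ, ∃ F : Finset (Site 3),
      (∀ u ∈ F, Function.Injective (unpinShape (2 ^ (j + 3)) u)) ∧
      ∀ᶠ k : ℕ in atTop, DoublingWindow θ k → ∀ᶠ n : ℕ in atTop,
        ∃ u ∈ F, meanScreening n n 0 (up (2 ^ (k + 3))) ((((2 ^ (k - j) : ℕ) : ℤ)) • u) (dn (2 ^ (k + 3))) ≤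
          1 - c') →
    Unpin := by
  intro h c θ _ hθ
  obtain ⟨c', hc', j, F, hinj, hk⟩ := h θ hθ
  exact ⟨c', hc', j, F, hinj, hk.mono fun k hkk hwin => (hkk hwin).mono fun n hn _ => hn⟩

end Summit.CriticalPhenomena.Ising3DConformalLimit.GapForcesFarMergingScreening

end
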